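import Summits.QuantumAdvantage.QuantumAdvantage.Theorems.LinnikCubicClassGroupsDegreeOnePrimesEscapeClassPNTDHLinnik
import Summits.QuantumAdvantage.QuantumAdvantage.Theorems.LinnikCubicClassGroupsDegreeOnePrimesEscapeClassPNTNoExceptionalDegOne
import HarnessLib

/-!
# The class prime number theorem with the Deuring–Heilbronn phenomenon, VI: degree-one primes

Topic `Summits/QuantumAdvantage/QuantumAdvantage/Theorems`, cell B2b-1 (linnik-cubic), PART A (gen 4);
helper toward the crux `DegreeOnePrimesEscape` (stmt-QuantumAdvantage-11543) of route
`LinnikCubicClassGroups`.  HONEST FRAMING: the value of this file is a THEOREM (kernel-checked,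
GRH-free) — NOT summit progress (the route still rests on the hypothesis-type target
`PureCubicClassNumberHard`).

`exists_degOnePrime_mem_class_absNorm_le_of_zeroRepulsion`: GIVEN the Deuring–Heilbronn phenomenon
(hypothesis `hDH`, the statement of `Literature.NumberTheory.LFunctions.NumberField.deuringHeilbronn`
verbatim), for every `n > 1` there is `L = L(n) > 0` such that every ideal class of every number field `K`
of degree `n` contains a prime ideal `𝔭` of RESIDUE DEGREE ONE (`N𝔭` a rational prime) with
`N𝔭 ≤ Q^{L}`, `Q = |d_K|·nⁿ` — the primes that the route's quantum algorithm samples.  (From the relative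
class prime number theorem `thetaClass_relative_of_zeroRepulsion`: `θ_C(x) ≥ c₁(n) x Q^{−6}/8` at
`x = Q^{L}` by Stark's effective bound, `π_C(x) ≥ θ_C(x)/log x`, and at most `n(√x + 1)` primes of a class
have residue degree `≥ 2`.)  The odd-degree case is unconditional in the tree since PART A seat 4
(`exists_degOnePrime_mem_class_absNorm_le_of_odd`); the unconditional all-degree version follows once the
Literature theorem `deuringHeilbronn` lands (`…LeastPrimeIdeal.lean`).

References: A. Weiss, J. reine angew. Math. 338 (1983), Thm. 5.2 / 6.4 [Weiss1983];
J. Thorner, A. Zaman, Algebra Number Theory 13 (2019), Thm. 1.4 [ThornerZaman2019].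
-/

noncomputable section

open Complex Real MeasureTheory Set Filter Topology
open scoped NumberField nonZeroDivisors

namespace Summit.QuantumAdvantage.QuantumAdvantage.Theorems.DegreeOnePrimesEscape

open Literature.NumberTheory.LFunctions Literature.NumberTheory.LFunctions.NumberField
  Literature.NumberTheory.LFunctions.AbelianDensity

/-- `θ_C(x) ≤ π_C(x) · log x` for `x ≥ 1` (every term `log N𝔭 ≤ log x`). [folklore] -/
theorem chebyshevThetaIdealClass_le_count_mul_log {K : Type} [Field K] [NumberField K]
    (C : ClassGroup (𝓞 K)) {x : ℝ} (hx : 1 ≤ x) :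
    chebyshevThetaIdealClass K C x ≤ primeIdealClassCount K C x * Real.log x := by
  classical
  rw [chebyshevThetaIdealClass_eq_sum_primeIdealsInClassLE K C (by linarith), primeIdealClassCount,
    Set.ncard_eq_toFinset_card _ (finite_primeIdealsInClassLE C x)]
  have h := Finset.sum_le_card_nsmul (finite_primeIdealsInClassLE C x).toFinset
    (fun P : Ideal (𝓞 K) ↦ Real.log (Ideal.absNorm P : ℝ)) (Real.log x) (fun P hP ↦ ?_)
  · rwa [nsmul_eq_mul] at h
  · rw [Set.Finite.mem_toFinset] at hP
    obtain ⟨-, hle, hP0, -⟩ := hP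
    have hpos : (0 : ℝ) < (Ideal.absNorm P : ℝ) := by
      exact_mod_cast Ideal.absNorm_pos_iff_mem_nonZeroDivisors.mpr hP0
    exact Real.log_le_log hpos hle

set_option maxHeartbeats 800000 in
/-- **Linnik's theorem for DEGREE-ONE prime ideals in every ideal class, every degree, given
Deuring–Heilbronn**: for `n > 1` there is `L > 0` such that every ideal class `C` of every number field `K`
of degree `n` contains a prime ideal whose norm is a rational prime `≤ Q^{L}`, `Q = |d_K|·nⁿ`.
Conditional only on `hDH` (the statement of the Literature theorem `deuringHeilbronn`).
[cite: Weiss1983, Theorem 5.2] [cite: ThornerZaman2019, Theorem 1.4] -/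
theorem exists_degOnePrime_mem_class_absNorm_le_of_zeroRepulsion
    (hDH : ∃ C : ℝ, 0 < C ∧ ∀ (K : Type) [Field K] [NumberField K] (χ₁ : ClassGroup (𝓞 K) →* ℂˣ),
      χ₁ * χ₁ = 1 → ∀ β₁ : ℝ, 0 < β₁ → β₁ < 1 → classGroupLFunction K χ₁ β₁ = 0 →
      ∀ (χ : ClassGroup (𝓞 K) →* ℂˣ) (ρ : ℂ), classGroupLFunction K χ ρ = 0 → 1 / 2 ≤ ρ.re → ρ ≠ 1 →
        ρ ≠ β₁ →
        Real.log (1 / (C * (Real.log ((NumberField.discr K).natAbs : ℝ) +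
            Module.finrank ℚ K * (Real.log (|ρ.im| + 2) + 1)) * (1 - β₁))) /
          (C * (Real.log ((NumberField.discr K).natAbs : ℝ) +
            Module.finrank ℚ K * (Real.log (|ρ.im| + 2) + 1))) ≤ 1 - ρ.re)
    (n : ℕ) (hn : 1 < n) :
    ∃ L : ℝ, 0 < L ∧ ∀ (K : Type) [Field K] [NumberField K], Module.finrank ℚ K = n →
      ∀ C : ClassGroup (𝓞 K), ∃ (P : Ideal (𝓞 K)) (hP : P ∈ (Ideal (𝓞 K))⁰), (Ideal.absNorm P).Prime ∧
        ClassGroup.mk0 ⟨P, hP⟩ = C ∧ (Ideal.absNorm P : ℝ) ≤ ThornerZaman.condQn K ^ L := by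
  classical
  obtain ⟨a₂, c, ha₂1, hc, hcn, hθ⟩ :=
    thetaClass_relative_of_zeroRepulsion hDH n hn (by norm_num : (0 : ℝ) < 1 / 2)
  obtain ⟨c₁, hc₁, hc₁1, heff⟩ := Residue.one_sub_realZero_ge_condQn_rpow n hn
  have hn2 : (2 : ℝ) ≤ n := by exact_mod_cast hn
  set L : ℝ := max (max a₂ 32) (80 + 128 / c₁) with hL
  have hLa₂ : a₂ ≤ L := le_trans (le_max_left _ _) (le_max_left _ _)
  have hL32 : (32 : ℝ) ≤ L := le_trans (le_max_right _ _) (le_max_left _ _)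
  have hLu : 80 + 128 / c₁ ≤ L := le_max_right _ _
  refine ⟨L, by linarith, fun K _ _ hKn C ↦ ?_⟩
  have hK : 1 < Module.finrank ℚ K := by rw [hKn]; exact hn
  set Q : ℝ := ThornerZaman.condQn K with hQ
  have hQ12 : (12 : ℝ) ≤ Q := ThornerZaman.twelve_le_condQn (K := K) hK
  have hQ1 : (1 : ℝ) < Q := by linarith
  have hQ0 : (0 : ℝ) < Q := by linarith
  have hQne : Q ≠ 0 := hQ0.ne'
  have hlogQ : 2 ≤ Real.log Q := two_lt_log_twelve.le.trans (Real.log_le_log (by norm_num) hQ12)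
  have hlogQQ : Real.log Q ≤ Q := by have := Real.log_le_sub_one_of_pos hQ0; linarith
  set x : ℝ := Q ^ L with hx
  have hxa₂ : Q ^ a₂ ≤ x := Real.rpow_le_rpow_of_exponent_le hQ1.le hLa₂
  have hxQ : Q ≤ x := by
    have := Real.rpow_le_rpow_of_exponent_le hQ1.le (show (1 : ℝ) ≤ L by linarith)
    rwa [Real.rpow_one] at this
  have hx1 : (1 : ℝ) < x := by linarith
  have hx0 : 0 < x := by linarith
  have hlogx : Real.log x = L * Real.log Q := by rw [hx, Real.log_rpow hQ0]
  have hlogx0 : 0 < Real.log x := Real.log_pos hx1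
  have hLlog : 32 * 2 ≤ L * Real.log Q := mul_le_mul hL32 hlogQ (by norm_num) (by linarith)
  have hlogx1 : 1 ≤ Real.log x := by rw [hlogx]; linarith
  have hL16 : 16 ≤ Real.log x := by rw [hlogx]; linarith
  have hL80 : 80 < L := by have := div_pos (by norm_num : (0 : ℝ) < 128) hc₁; linarith
  set h : ℝ := (NumberField.classNumber K : ℝ) with hh
  have hh1 : 1 ≤ h := by rw [hh]; exact_mod_cast one_le_classNumber (K := K)
  have hh0 : 0 < h := by linarith
  have hhQ : h ≤ Q ^ 4 := by
    have := ThornerZaman.classNumber_le_condQn_pow (K := K) hK; rw [← hQ] at this; exact this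
  have hnQ : (Module.finrank ℚ K : ℝ) ≤ Q := ThornerZaman.finrank_le_condQn (K := K)
  have hQm2' : 0 < Q ^ (-(2 : ℝ)) := Real.rpow_pos_of_pos hQ0 _
  have hQm2 : Q ^ (-(2 : ℝ)) ≤ 1 := Real.rpow_le_one_of_one_le_of_nonpos hQ1.le (by norm_num)
  set m' : ℝ := c₁ * Q ^ (-(2 : ℝ)) with hm'
  have hm'0 : 0 < m' := mul_pos hc₁ hQm2'
  have hm'1 : m' ≤ 1 := (mul_le_mul hc₁1 hQm2 hQm2'.le zero_le_one).trans (by norm_num)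
  have hm'2 : m' = c₁ * (Q ^ 2)⁻¹ := by rw [hm', Real.rpow_neg hQ0.le, Real.rpow_two]
  -- Step 1: `θ_C(x) ≥ x m' / (8 h)`
  have hθlow : x * m' / (8 * h) ≤ chebyshevThetaIdealClass K C x := by
    have hcmp : x * m' / (8 * h) ≤ x / h - 1 / 2 * x / h := by
      rw [show x / h - 1 / 2 * x / h = x * 4 / (8 * h) by field_simp; ring]
      exact div_le_div_of_nonneg_right (mul_le_mul_of_nonneg_left (by linarith) hx0.le) (by positivity)
    rcases hθ K hKn with hgood | ⟨χ₁, β₁, hreal, hβlow, hβ1, hLz, hexc⟩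
    · have h1 := (abs_sub_le_iff.1 (hgood x hxa₂ C)).2
      linarith
    · obtain ⟨hM0, hb⟩ := hexc x hxa₂ C
      have h1 := (abs_sub_le_iff.1 hb).2
      have hδ : m' ≤ 1 - β₁ := heff K hKn χ₁ hreal β₁ hβ1 hLz
      have hβ34 : 3 / 4 ≤ β₁ := by
        have hlog4 : 1 < Real.log 4 := by
          rw [show (4:ℝ) = 2 ^ 2 by norm_num, Real.log_pow]; have := Real.log_two_gt_d9; push_cast; linarith
        have hlogd : 0 ≤ Real.log ((NumberField.discr K).natAbs : ℝ) := Real.log_natCast_nonneg _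
        have hc4 : c ≤ 1 / 4 := by
          refine hcn.trans ?_
          rw [div_le_div_iff_of_pos_left one_pos (by positivity) (by norm_num)]
          have := sq_nonneg (n : ℝ); linarith
        have : c / (Real.log ((NumberField.discr K).natAbs : ℝ) + Real.log 4) ≤ 1 / 4 := by
          rw [div_le_iff₀ (by linarith)]; linarith
        linarith
      have hM := sub_mul_rpow_div_ge hx1 hL16 hβ34 hβ1 (abs_re_classGroupChar_apply_le hreal C)
      have hmin : m' ≤ min 1 ((1 - β₁) * Real.log x) := by
        refine le_min hm'1 (hδ.trans ?_)
        have := mul_le_mul_of_nonneg_left hlogx1 (by linarith : (0 : ℝ) ≤ 1 - β₁); linarith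
      set M : ℝ := x - ((χ₁ C : ℂ)).re * x ^ β₁ / β₁ with hMdef
      have hM' : x / 4 * m' ≤ M := le_trans (mul_le_mul_of_nonneg_left hmin (by positivity)) hM
      have h2 : x * m' / (8 * h) ≤ M / h - 1 / 2 * M / h := by
        rw [show M / h - 1 / 2 * M / h = M * 4 / (8 * h) by field_simp; ring]
        exact div_le_div_of_nonneg_right (by linarith) (by positivity)
      linarith
  -- Step 2: `π_C(x) ≥ θ_C(x)/log x` and the degree-`≥ 2` count
  have hπ : x * m' / (8 * h) / Real.log x ≤ primeIdealClassCount K C x := by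
    have := chebyshevThetaIdealClass_le_count_mul_log C hx1.le
    rw [div_le_iff₀ hlogx0]; linarith
  have hdeg := primeIdealClassCount_sub_degOneClassCount_le K C hx0.le
  -- Step 3: `16 L Q⁸ < c₁ √x` (`√x = Q⁸ · Q^{L/2 − 8} ≥ Q⁸ e^{L−16} ≥ Q⁸ (L−16)²/4`)
  have hsx0 : 0 < Real.sqrt x := Real.sqrt_pos.2 hx0
  have hxx : Real.sqrt x * Real.sqrt x = x := Real.mul_self_sqrt hx0.le
  have hC : 16 * L * Q ^ 8 < c₁ * Real.sqrt x := by
    have hsx : Real.sqrt x = Q ^ (8 : ℝ) * Q ^ (L / 2 - 8) := by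
      rw [Real.sqrt_eq_rpow, hx, ← Real.rpow_mul hQ0.le, ← Real.rpow_add hQ0]; ring_nf
    have hQ8 : Q ^ (8 : ℝ) = Q ^ 8 := by norm_cast
    have hexp : Real.exp (L - 16) ≤ Q ^ (L / 2 - 8) := by
      rw [Real.rpow_def_of_pos hQ0, Real.exp_le_exp]
      have : 2 * (L / 2 - 8) ≤ Real.log Q * (L / 2 - 8) :=
        mul_le_mul_of_nonneg_right hlogQ (by linarith)
      linarith
    have hu : (L - 16) ^ 2 / 4 ≤ Real.exp (L - 16) := by
      have h1 := Real.add_one_le_exp ((L - 16) / 2)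
      have h2 : Real.exp (L - 16) = Real.exp ((L - 16) / 2) * Real.exp ((L - 16) / 2) := by
        rw [← Real.exp_add]; ring_nf
      rw [h2]
      have h3 : 0 ≤ (L - 16) / 2 + 1 := by linarith
      have h4 := mul_le_mul h1 h1 h3 (Real.exp_pos _).le
      have e : ((L - 16) / 2 + 1) * ((L - 16) / 2 + 1) = (L - 16) ^ 2 / 4 + (L - 16) + 1 := by ring
      linarith
    have hpoly : 16 * L < c₁ * ((L - 16) ^ 2 / 4) := by
      have hu0 : 64 + 128 / c₁ ≤ L - 16 := by linarith
      have h1 : 16 * c₁ + 32 ≤ c₁ * (L - 16) / 4 := by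
        have := mul_le_mul_of_nonneg_left hu0 hc₁.le
        have e : c₁ * (64 + 128 / c₁) = 64 * c₁ + 128 := by field_simp
        linarith
      have h2 : (16 * c₁ + 32) * (L - 16) ≤ c₁ * (L - 16) / 4 * (L - 16) :=
        mul_le_mul_of_nonneg_right h1 (by linarith)
      have h3 : 0 ≤ c₁ * (L - 16) := mul_nonneg hc₁.le (by linarith)
      have e1 : c₁ * (L - 16) / 4 * (L - 16) = c₁ * ((L - 16) ^ 2 / 4) := by ring
      have e2 : (16 * c₁ + 32) * (L - 16) = 16 * (c₁ * (L - 16)) + 32 * L - 512 := by ring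
      linarith
    calc 16 * L * Q ^ 8 < c₁ * ((L - 16) ^ 2 / 4) * Q ^ 8 := mul_lt_mul_of_pos_right hpoly (pow_pos hQ0 8)
      _ ≤ c₁ * Q ^ (L / 2 - 8) * Q ^ 8 :=
          mul_le_mul_of_nonneg_right (mul_le_mul_of_nonneg_left (hu.trans hexp) hc₁.le) (by positivity)
      _ = c₁ * Real.sqrt x := by rw [hsx, hQ8]; ring
  -- Step 4: `n (√x + 1) < x m'/(8 h log x)`
  have hkey : (Module.finrank ℚ K : ℝ) * (Real.sqrt x + 1) < x * m' / (8 * h) / Real.log x := by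
    have hsqrt1 : 1 ≤ Real.sqrt x := by rw [← Real.sqrt_one]; exact Real.sqrt_le_sqrt hx1.le
    have hn0 : (0 : ℝ) ≤ (Module.finrank ℚ K : ℝ) := Nat.cast_nonneg _
    have hA : (Module.finrank ℚ K : ℝ) * (Real.sqrt x + 1) ≤ 2 * Q * Real.sqrt x :=
      calc (Module.finrank ℚ K : ℝ) * (Real.sqrt x + 1) ≤ Q * (Real.sqrt x + 1) :=
            mul_le_mul_of_nonneg_right hnQ (by positivity)
        _ ≤ Q * (2 * Real.sqrt x) := mul_le_mul_of_nonneg_left (by linarith) hQ0.le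
        _ = 2 * Q * Real.sqrt x := by ring
    have hden : 0 < 8 * h * Real.log x := by positivity
    have hden' : 8 * h * Real.log x ≤ 8 * L * Q ^ 5 := by
      rw [hlogx]
      have h1 : h * (L * Real.log Q) ≤ Q ^ 4 * (L * Real.log Q) :=
        mul_le_mul_of_nonneg_right hhQ (by positivity)
      have h2 : Q ^ 4 * (L * Real.log Q) ≤ Q ^ 4 * (L * Q) :=
        mul_le_mul_of_nonneg_left (mul_le_mul_of_nonneg_left hlogQQ (by linarith)) (by positivity)
      have e1 : 8 * h * (L * Real.log Q) = 8 * (h * (L * Real.log Q)) := by ring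
      have e2 : 8 * L * Q ^ 5 = 8 * (Q ^ 4 * (L * Q)) := by ring
      rw [e1, e2]; linarith
    have h1 : x * m' / (8 * L * Q ^ 5) ≤ x * m' / (8 * h) / Real.log x := by
      rw [div_div]; exact div_le_div_of_nonneg_left (by positivity) hden hden'
    have h2 : 2 * Q * Real.sqrt x < x * m' / (8 * L * Q ^ 5) := by
      rw [lt_div_iff₀ (by positivity), hm'2]
      have e1 : 2 * Q * Real.sqrt x * (8 * L * Q ^ 5) = (16 * L * Q ^ 8) * Real.sqrt x * (Q ^ 2)⁻¹ := by
        field_simp; ring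
      have hQ2pos : 0 < (Q ^ 2)⁻¹ := by positivity
      have h3 : (16 * L * Q ^ 8) * Real.sqrt x * (Q ^ 2)⁻¹ < (c₁ * Real.sqrt x) * Real.sqrt x * (Q ^ 2)⁻¹ :=
        mul_lt_mul_of_pos_right (mul_lt_mul_of_pos_right hC hsx0) hQ2pos
      have e3 : (c₁ * Real.sqrt x) * Real.sqrt x * (Q ^ 2)⁻¹ = x * (c₁ * (Q ^ 2)⁻¹) := by
        rw [mul_assoc c₁, hxx]; ring
      linarith [e1, h3, e3]
    linarith
  -- hence a degree-one prime exists in `C` below `x`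
  have hpos : 0 < (degOneClassCount K C x : ℝ) := by linarith
  have hne : degOneClassCount K C x ≠ 0 := by
    intro h0; rw [h0, Nat.cast_zero] at hpos; exact lt_irrefl _ hpos
  obtain ⟨P, hPprime, hPx, hP0, hPC⟩ := Set.nonempty_of_ncard_ne_zero hne
  exact ⟨P, hP0, hPprime, hPC, hPx⟩

end Summit.QuantumAdvantage.QuantumAdvantage.Theorems.DegreeOnePrimesEscape

end
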